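import Literature.NumberTheory.EllipticCurves.KatoAdditiveTwistedValueNeronIntegrality
import HarnessLib

/-!
# Kato's integral zeta elements read in NÉRON units at the ADDITIVE prime `p = 3`, for tame characters
# with `χ(3) ∉ {1, −1}` (the Kosters–Pannekoek `3`-torsion of `E₀` over unramified extensions is a
# Frobenius eigenline of the dual-exponential receptacle and is invisible to such `χ`) — named fact

Topic `NumberTheory/EllipticCurves`. ONE named fact (`def … : Prop`, D-0014), the `p = 3` sibling of
`kato_neron_isIntegral_twistedSymbolSum_of_additive` (`7 < p`) and
`kato_neron_isIntegral_twistedSymbolSum_of_additive_five_le` (`5 ≤ p`, off the Kosters–Pannekoek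
exceptional class) of `KatoAdditiveTwistedValueNeronIntegrality.lean`: same conclusion, same shape
(all characters of order prime to `p`, symmetrised Euler factor, `IsIntegral` form), same derivation
items 1, 3, 4, with the RECEPTACLE item 2 replaced at `p = 3` by the trace dual of `log_ω E₀(K)` computed
from Kosters–Pannekoek's explicit multiplication-by-`3` map, and ONE further elementary step (the "polar
invisibility" computation (P1)–(P5) below) which is NOT in print as such: it is a DERIVED READING, weaker
than the derivation in every binder, flagged for the referee. Requested by cell `pub/bsd-f2-manin`
(Euler-system lens, MEMO-es §18, typing ask T-es-9; row F-es-18 of its CANDIDATES.md), audited there by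
two refuter seats (REFUTER-ref1 §R34: steps (P1)–(P5) checked against the printed pages; REFUTER-ref2
§L⁷: placement "print-corollary; eigenline reading not in print, nearest Delbourgo 2002"). Consumer: the
line `kato-shift-three` of crux `ManinPrimeToThreeAtNine` (item stmt-BirchSwinnertonDyer-22968 of route
`Summits/BirchSwinnertonDyer/BirchSwinnertonDyer/Theses/ManinLocalTwoThree.lean`), whose registered stub
`stub_katoFactThreePolar` is this statement with the symmetrised Euler factor abbreviated `symmEuler`.

## The printed statements (first-hand; page/line locators are to the held copies)

* K. Kato, Astérisque 295 (2004) [Kato2004Asterisque] (held `paper:doi-10-24033-ast-639`, PDF p. 65 =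
  p. 180; Chapter II opens "In this Chapter II, we fix a prime number p" — no restriction on `p`).
  **(8.1.3)**: `_{c,d} z_m^{(p)}(f, r, r', ξ, S) ∈ H¹(ℤ[1/p, ζ_m], V_{O_λ}(f)(k − r))` "where `m ≥ 1`,
  `f` is a normalized newform, `ξ, S, r, r', c, d` are as in (8.1.2)" — i.e. `p ∈ S`, `1 ≤ r' ≤ k − 1`,
  `prime(cd) ∩ S = ∅`, `(cd, 6) = 1`, `(d, N) = 1` — "`λ` is a finite place of `F = ℚ(a_n ; n ≥ 1)`, and
  `O_λ` is the valuation ring of `λ`"; "Those with `ξ ∈ SL₂(ℤ)` can not take care of bad Euler factors,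
  but will take care of delicate integrality." **Thm. 9.7** (p. 189): `exp*` sends the image of
  `_{c,d} z_m^{(p)}(f, r, r', ξ, S)` to `_{c,d} δ_m(f, r, r', ξ, S)`. **Thm. 6.6 (1)** (p. 163): for a
  character `χ : (ℤ/m)^× → ℂ^×`, `Σ_{b ∈ (ℤ/m)^×} χ(b) per_f(σ_b(_{c,d} δ_m(f, r, r', ξ, S)))^± =
  T · L_S(f*, χ, r)·(2πi)^{k−r−1}·γ^±` (`f* = f` for the rational newform `f`), with `T = (c² − c^u χ̄(c))(d² − d^v χ̄(d))` (BOTH characters barred, as printed — p. 163, second display; the reading `χ(c)` formerly written here was erratum F-UE-1 / docket DD-213, cf. `Kato2004.exists_member_sl2ZetaElement_neron_values_bar`) in the case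
  `ξ ∈ SL₂(ℤ)`, `c ≡ d ≡ 1 mod N` (cf. Thm. 12.6 (2), p. 222: "`a ∈ SL₂(ℤ)`, `(cd, 6pN) = 1`,
  `c ≡ d ≡ 1 mod N`"). Remark after **(12.8.1)** (p. 223): if (12.5.2) holds for one stable lattice, all
  `Gal(ℚ̄/ℚ)`-stable `O_λ`-lattices of `V_{F_λ}(f)` have the form `aT`, `a ∈ F_λ^×`; the same conclusion
  holds as soon as `T/𝔪T` is irreducible (a stable lattice `L ⊆ T`, `L ⊄ 𝔪T`, maps onto a non-zero
  stable subspace of `T/𝔪T`) — any `p`.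
* M. Kosters, R. Pannekoek, arXiv:1703.07888 [KostersPannekoek2017] (held `paper:arxiv-1703.07888`).
  **Thm. 1** (p. 3): "Assume that `K/ℚ_p` is unramified of degree `n` … `a_i ∈ 𝔪_K = pO_K` for each
  `i`. Then one has `E₀(K) ≅_{ℤ_p} ℤ_pⁿ`, except in the following four cases: … (ii) `p = 3` and
  `N_{k/𝔽_p}(\overline{8a₂/3}) = 1`; … In the cases (ii)-(iv), one has `E₀(K) ≅_{ℤ_p} ℤ_pⁿ × ℤ/pℤ`."
  **Cor. 2** (p. 3): over `ℚ_p`, "(ii) `p = 3` and `a₂ ≡ 6 (mod 9)`". **Lemma 9** (p. 6): "any curve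
  with additive reduction can be written in the form of Theorem 1". **Prop. 10** (p. 6): for `i > e/(p−1)`,
  `E_i(K) ≅_{ℤ_p} ℤ_pⁿ` and `pE_i(K) = E_{i+e}(K)` (by the logarithm, [SI] IV); p. 5: the logarithm
  isomorphisms `Ê(𝔪_K^i) ≅ 𝔪_K^i` (`i > e/(p−1)`) commute with the inclusions. **Lemma 7** (p. 5):
  for `0 → ℤ_p^a → G → H → 0` with `H` `pⁿ`-torsion and `g(π(x)) := τ(pⁿx)`, `G ≅ ℤ_p^a ⊕ ker(g)`, and
  if `ker g = 0` "one can identify `G` with `1/pⁿ(τ⁻¹ im(g)) ⊇ ℤ_p^a`". **§3.3 and §3.3.1** (p. 7):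
  with `0 → E₁(K) → E₀(K) → Ẽ_sm(k) ≅ k⁺ → 0` and `e = 1`, "We have a map
  `g : k → Ê(𝔪_K¹)/Ê(𝔪_K²) ≅ k` … The map `g` is given by a polynomial. For `p > 7`, this is the
  identity map … For `p = 3, 5, 7` this polynomial is of the form `T − aT^p`"; the table: `p = 3`:
  `[p](T) = 3T − 3a₁T² + (a₁² − 8a₂)T³ + …`, `g = T − \overline{8a₂/3}·T³`; "if there is no torsion in
  `E₀(K)`, then the map `g` is surjective, and by Lemma 7 one has `pE₀(K) = E₁(K)` (one identifies
  `E₀(K)` with `O_K` …)". **Lemma 8** (p. 5): `X − aX^p` has all its roots in `k` iff `N_{k/𝔽_p}(a) = 1`.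
  **Example 14** (p. 7): `E₃ : Y² = X³ − 3X² + 3X` is additive at `3` with the `3`-torsion point `(1,1)`
  of good reduction (`a₂ = −3 ≡ 6 mod 9`: case (ii) over `ℚ₃`).
* C.-H. Kim, K. Nakamura, J. Number Theory 210 (2020) [KimNakamura2020] (held `paper:arxiv-1808.07726`,
  p. 5): "we have a perfect pairing `Tr ∘ ⟨−,−⟩_dR : Fil⁰D_dR(V) × D_dR(V)/Fil⁰D_dR(V) → K → ℚ_p` where
  the first map is induced from the local Tate duality and the second map is the trace map … By the
  local Tate duality, we have the following statement. **Corollary 2.4.** The image of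
  `H¹(K,T)/H¹_f(K,T)` under `exp*` is `O_K ω_E` where `H¹_f(K,T)` is the image of the Kummer map of
  `E(K) ⊗ ℤ_p`" (there: `log_E(E(K) ⊗ ℤ_p) = O_K`, the non-exceptional case). What is used below is only
  the MECHANISM of this corollary — `exp*_ω` of an INTEGRAL class pairs integrally, through
  `Tr_{K/ℚ_p}(exp*_ω(z) · log_ω(P))`, with the Kummer classes of `E(K)` — applied to a receptacle
  which at `p = 3` may be larger than `O_K`.
* D. Delbourgo, J. Number Theory 95 (2002) [Delbourgo2002] (held
  `paper:delbourgo2002-p-adic-birch-swinnerton-dyer-conjecture-non`, p. 50 L60–63): "`Tr_{K_m/ℚ_p}[exp*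
  (x), W] = inv(x ∪ exp W)` … by the definition of `exp*`" — the duality identity behind (P4); and §1
  (pp. 39–40): the correction factor `ℓ_p(E)` to the `p`-adic BSD formula at an additive `p` is present
  exactly when the reduction over `ℚ_p^{nr}` acquires `p`-torsion — the same pole of `exp*` that (P5)
  below makes invisible to `χ` (nearest printed phenomenon; Delbourgo measures the pole, he does not
  twist it away).
* S. Bloch, K. Kato, in The Grothendieck Festschrift I (1990) [BlochKato1990], §3 (Def. 3.10, Prop. 3.8
  and (3.11)): `exp`, `H¹_f`, and `exp*` as the transpose of `exp` under local Tate duality.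
* C. Wuthrich, Doc. Math. 19 (2014) [Wuthrich2014] §3 Prop. 8; B. Mazur, J. Tate, J. Teitelbaum (1986)
  §I.8 (8.6) (Birch's formula; tree `twistedSymbolSum`) — as in the sibling.

## The derivation (the typed statement is its last line)

Notation as in the sibling's items 1–4 (module docstring of `KatoAdditiveTwistedValueNeronIntegrality`):
`V/ℚ` globally minimal, ADDITIVE at `p = 3`, `E[3]` irreducible, newform `f` of level `N` (so `9 ∣ N`
is not assumed here — additivity is the hypothesis), `(m, 3N) = 1`, `K = ℚ(ζ_m)`, `χ` primitive mod
`m`, `χ ≠ 1`, `3 ∤ ord χ`; for `v ∣ 3`, `K_v ≅ ℚ_{3^f}` is UNRAMIFIED (`3 ∤ m`), `f = ord_m(3)`, residue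
field `k_v`, Frobenius `σ`; the Frobenius `σ₃ ∈ Gal(K/ℚ)` (`ζ_m ↦ ζ_m³`) preserves every `v ∣ 3` and
induces `σ` on `K_v`.
1. (Lattice, = sibling item 1, any `p`.) `E[3]` irreducible ⟹ every stable `ℤ₃`-lattice of `V₃E` is
   `3^a T₃E` (remark after (12.8.1)); with Wuthrich's Prop. 8, Kato's (8.1.3) gives, `ℤ₃`-linearly in
   `γ ∈ H₁(E(ℂ), ℤ)`, classes `z_γ ∈ H¹(O_K[1/3], T₃E)` (`r = r' = 1`, `ξ ∈ SL₂(ℤ)`, `S = prime(3mN)`,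
   `prime(cd) ∩ S = ∅`, `(cd, 6) = 1`, `c ≡ d ≡ 1 mod N`).
2. (Receptacle at `p = 3` — replaces the sibling's item 2.) Over `K_v = ℚ_{3^f}` put the (minimal,
   additive) model in the form of K–P Thm. 1 (`a_i ∈ 3O`, Lemma 9) and let `ā := \overline{8a₂/3} ∈ 𝔽₃`
   (the curve is defined over `ℚ₃`, so `ā` lies in the PRIME field; `ā = 1` iff `V(ℚ₃)` is in case (ii)
   of Cor. 2). Let `M₀ := log_ω E₀(K_v) ⊂ K_v` and `R := M₀^∨ := {x ∈ K_v : Tr_{K_v/ℚ₃}(x·M₀) ⊆ ℤ₃}`.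
   (P1) `log E₁(K_v) = 3O` (Prop. 10 / [SI] IV.6.4: `e = 1 < p − 1`), `3E₀ ⊆ E₁` (`E₀/E₁ ≅ k⁺`),
        `3E₁ = E₂` (Prop. 10), and `log` extended to `E₀(K_v)` by `log P := log(3P)/3` has image
        `M₀ = {u ∈ O : ū ∈ im(g)} ⊇ 3O`, `g : k → k`, `x ↦ x − ā x³` the 𝔽₃-LINEAR map of §3.3.1
        (multiplication by `3` from `E₀/E₁ = k` to `E₁/E₂ = 𝔪/𝔪² = k`; `log T ≡ T mod 9O` on `𝔪`, so the
        graded identifications by `T` and by `log` agree). [K–P §3.3.1 table `p = 3`; Lemma 7.]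
   (P2) The annihilator of `im(g)` under the trace form `(x, y) ↦ Tr_{k/𝔽₃}(xy)` is
        `ℓ_ā := {y ∈ k : y³ = ā·y}`: `Tr(y·āx³) = Tr((āy)^{1/3}·x)` (Frobenius-invariance of the trace,
        `ā ∈ 𝔽₃`), so `Tr(y·g(x)) = Tr((y − (āy)^{1/3})·x)` vanishes for all `x` iff `y³ = āy`. `ℓ_ā` is
        an `𝔽₃`-subspace of dimension `≤ 1` (its non-zero elements satisfy `y² = ā`), non-zero iff `ā = 1`,
        or `ā = −1` and `f` even — i.e. iff `N_{k/𝔽₃}(ā) = ā^f = 1`, which is exactly case (ii) of K–P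
        Thm. 1 (Lemma 8), as it must be.
   (P3) Hence `M₀ = O` and `R = O` when `ℓ_ā = 0` (Kim–Nakamura's case), and otherwise, for a generator
        `y₀` of `ℓ_ā` with a lift `ỹ ∈ O`: `M₀ = {u ∈ O : Tr(ỹu) ∈ 3ℤ₃}` and
        `R = O + 3⁻¹ℤ₃·ỹ` (lattice duality in the unramified `K_v`: `O^∨ = O`), where `y₀³ = ā y₀` says
        `σ(ỹ) ≡ ā·ỹ (mod 3O)`: THE POLAR LINE OF `R` IS A FROBENIUS EIGENLINE WITH EIGENVALUE `ā ∈ {±1}`.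
   (P4) For `z ∈ H¹(K_v, T₃E)` and `P ∈ E(K_v)`: `⟨z, κ(P)⟩_{Tate} = ± Tr_{K_v/ℚ₃}(exp*_ω(z) · log_ω(P))`
        (Delbourgo p. 50; Bloch–Kato §3; Kim–Nakamura p. 5), and the left side lies in `ℤ₃` (cup product
        of integral classes into `H²(K_v, ℤ₃(1)) = ℤ₃` via the Weil pairing). Hence
        `exp*_ω H¹(K_v, T₃E) ⊆ (log_ω E(K_v))^∨ ⊆ (log_ω E₀(K_v))^∨ = R` — stated with `E(K_v)`, so the
        component group (which at `p = 3` may have order `3`: types IV, IV*) plays no role.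
   (P5) GLOBAL CONSEQUENCE. Let `X = (X_v)_{v∣3} ∈ ∏_{v∣3} R_v ⊂ K ⊗ ℚ₃` and
        `Λ(χ, X) := Σ_{b ∈ (ℤ/m)^×} χ(b)σ_b(X)`. Write `X = X⁰ + 3⁻¹Y`, `X⁰ ∈ ∏_v O_v`,
        `Y = (c_v ỹ_v)_v`, `c_v ∈ ℤ₃`, so that `σ₃(Y) ≡ ā·Y (mod 3)`. Substituting `b ↦ 3b` (`3 ∈ (ℤ/m)^×`):
        `S := Σ_b χ(b)σ_b(Y) = χ(3)·Σ_b χ(b)σ_b(σ₃Y) ≡ χ(3)·ā·S (mod 3)`, i.e. `(1 − χ(3)ā)·S ≡ 0 (mod 3)`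
        in `O_K[χ] ⊗ ℤ₃`; `χ(3)ā` is a root of unity of order prime to `3`, so `1 − χ(3)ā` is a `3`-adic
        unit unless `χ(3)ā = 1`. CONCLUSION: `Λ(χ, X)` is `3`-integral whenever `χ(3)·ā ≠ 1`; in
        particular — curve-free — whenever `χ(3) ∉ {1, −1}`.
3. (Values, = sibling item 3 with (b) symmetric Euler factor.) Thm. 9.7 + Thm. 6.6 (1), `γ` and `ω`
   both on `E` (the Manin constant of the parametrisation cancels), `S = prime(3mN)` (the Euler factors at
   the additive prime `3` and at `ℓ ∣ m` are `1`): `Σ_b χ(b) σ_b(exp*_ω(loc z_γ)) = T · L_S(E, χ, 1)/Ω^±_γ`.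
4. (Units, = sibling item 4 (a).) `c ≡ d ≡ 1 (mod N)` and `3 ∣ N` give `T ≡ (1 − χ̄(c))(1 − χ̄(d))` modulo
   every prime above `3`; choose `c, d` (CRT, `(m, 6N) = 1` up to the harmless factor `2`) with `χ(c)`,
   `χ(d)` generators of `μ_n`, `n = ord χ > 1`, `3 ∤ n`: `1 − ζ_n` is a `3`-unit, so `T` is; `3 ∤ cd` holds
   because `c ≡ d ≡ 1 (mod N)`; `τ(χ)τ(χ̄) = ±m` and the `ℓ ∥ N` are prime to `3`. With Birch's formula the
   `χ`-sum of item 3 is `Λ(χ, X)` for `X = exp*_ω(loc₃ z_γ) ∈ ∏_v R_v` (items 1, 2 (P4)), and (P5) gives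
   its `3`-integrality under `χ(3) ∉ {±1}`.
HENCE, the typed reading: for `V/ℚ` globally minimal (Néron periods `Ω(V) = V.realPeriodRat`,
`|Ω⁻(V)| = V.imaginaryPeriodRat`) with newform `f` at level `N`, ADDITIVE at `3`, `E[3]` irreducible,
`(m, 3N) = 1`, `χ` primitive mod `m`, `χ ≠ 1`, `3 ∤ ord χ`, `χ(3) ≠ 1`, `χ(3) ≠ −1`, and `ϖ ∈ ℚ`, `r ∈ ℂ`
with (`χ` even) `ϖ·Ω(V) = Ω⁺_f`, `∏_{ℓ∥N}(ℓ − a_ℓχ(ℓ))(ℓ − a_ℓχ(ℓ)⁻¹)·Σ_aχ(a){∞,a/m}_f = r·Ω⁺_f`, resp.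
(`χ` odd) `ϖ·|Ω⁻(V)| = Ω⁻_f`, same product `= r·Ω⁻_f·i`: `s·ϖ·r` is an algebraic integer for some `s ∈ ℕ`
with `3 ∤ s`. NO Manin-constant binder, NO modular-degree binder, and NO curve-side Kosters–Pannekoek
(receptacle) binder: the K–P class of `V` at `3` decides only WHICH characters certify (`χ(3)ā ≠ 1`); the
typed statement keeps the curve-free part `χ(3) ∉ {1, −1}` (both signs excluded — weaker than (P5)).

WHAT IS PRINT AND WHAT IS READING. Printed verbatim: Kato (8.1.3), 9.7, 6.6 (1), the lattice remark;
K–P Thm. 1 (ii), Cor. 2 (ii), Lemma 7, Prop. 10, the §3.3.1 table; the duality identity (Delbourgo p. 50,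
Bloch–Kato §3, Kim–Nakamura p. 5 / Cor. 2.4). Non-verbatim (flag for the referee:
`Kato-(8.1.3)-9.7-6.6-KostersPannekoek-3.3.1-additive-three-twisted-Neron-reading-polar`): the sibling's
three steps (lattice transfer under irreducibility; period bookkeeping; unit choice / convention-proofing)
AND the receptacle computation (P1)–(P5) — elementary (an `𝔽₃`-linear map, its trace-orthogonal, lattice
duality in an unramified field, one character-sum substitution), written out in full above, checked
independently by two refuter seats of cell `pub/bsd-f2-manin` (REFUTER-ref1 §R34 (A): "(1)–(5) CHECKED
on paper against K–P p. 3 L27, p. 7 L22–48 … (4) correctly stated with E(K)"; REFUTER-ref2 §L⁷ (α)), and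
NOT found in print as a statement (nearest: Delbourgo 2002 §1, the correction `ℓ_p(E)` for the same
pole). Consistency checks: K–P Example 14 (`ā = 1` over `ℚ₃`, `M₀ = 3ℤ₃ ∌` unit, `R = 3⁻¹ℤ₃`: the
receptacle loses exactly one `3`, recovered by every `χ` with `χ(3) ≠ 1`); the cell's twisted-value
censuses at `p = 3` (HOME/es/E16*-*.tsv: 8 889 + 3 396 unit-normalised values, none `3`-nonintegral).
No `_holds` (size XL: Kato's explicit reciprocity law). Never stronger than the derivation: every binder
of the derivation is kept, and the conclusion is its last line.

## References

* K. Kato, Astérisque 295 (2004): (8.1.2)–(8.1.3) (p. 180), Thm. 6.6 (p. 163), Thm. 9.7 (p. 189),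
  Thm. 12.6 (2) (p. 222), remark after (12.8.1) (p. 223). [Kato2004Asterisque]
* M. Kosters, R. Pannekoek, arXiv:1703.07888 (2017): Thm. 1 (ii), Cor. 2 (ii), Lemma 7, Lemma 8,
  Lemma 9, Prop. 10, §3.3, §3.3.1 (table), Example 14. [KostersPannekoek2017]
* C.-H. Kim, K. Nakamura, J. Number Theory 210 (2020) = arXiv:1808.07726: §2.1 (perfect pairing
  `Tr ∘ ⟨−,−⟩_dR`), Cor. 2.4. [KimNakamura2020]
* D. Delbourgo, J. Number Theory 95 (2002) 38–71: §1 (`ℓ_p(E)`), p. 50 (duality identity). [Delbourgo2002]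
* S. Bloch, K. Kato, The Grothendieck Festschrift I (1990): §3 (Prop. 3.8, Def. 3.10, (3.11)).
  [BlochKato1990]
* C. Wuthrich, Doc. Math. 19 (2014): §3 Prop. 8. [Wuthrich2014]
* B. Mazur, J. Tate, J. Teitelbaum, Invent. Math. 84 (1986): §I.8 (8.6). [MazurTateTeitelbaum1986]
-/

noncomputable section

open scoped MatrixGroups ModularForm Classical

open CongruenceSubgroup Literature.NumberTheory.EllipticCurves.ModularForms

namespace Literature.NumberTheory.EllipticCurves

/-- **Kato's Euler system read in Néron units at the ADDITIVE prime `3` with `E[3]` irreducible, for every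
primitive Dirichlet character `χ` of order prime to `3`, conductor `m` prime to `3N`, and `χ(3) ∉ {1, −1}`:
the `N`-imprimitive (symmetrised) Birch–Manin twisted value is `3`-integral against the NÉRON periods** —
the `p = 3` sibling of `kato_neron_isIntegral_twistedSymbolSum_of_additive` (`7 < p`) and
`kato_neron_isIntegral_twistedSymbolSum_of_additive_five_le`, with the same conclusion and the binder
`7 < p` replaced by `p = 3` together with the CHARACTER-SIDE condition `χ(3) ≠ 1 ∧ χ(3) ≠ −1` (no
curve-side Kosters–Pannekoek hypothesis). A derived reading (weaker than the derivation, never stronger)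
of: K. Kato, Astérisque 295 (2004), **(8.1.3)** (p. 180: `_{c,d}z_m^{(p)}(f, r, r′, ξ, S) ∈
H¹(ℤ[1/p, ζ_m], V_{O_λ}(f)(k − r))` for `m ≥ 1`, `p ∈ S`, `prime(cd) ∩ S = ∅`, `(cd, 6) = 1`, `(d, N) = 1`
— "In this Chapter II, we fix a prime number `p`", no further restriction), **Thm. 9.7** (p. 189: `exp*`
sends it to `_{c,d}δ_m(f, r, r′, ξ, S)`), **Thm. 6.6 (1)** (p. 163: `Σ_b χ(b) per_f(σ_b δ)^± =
T·L_S(f*, χ, r)·(2πi)^{k−r−1}·γ^±` (`f* = f`), `T = (c² − c^uχ̄(c))(d² − d^vχ̄(d))` for `ξ ∈ SL₂(ℤ)`,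
`c ≡ d ≡ 1 mod N`; here `k = 2`, `r = r′ = 1`, `S = prime(3mN)`, so `L_S(f,χ,1) = L(f,χ,1)·∏_{ℓ∥N}(1 −
a_ℓχ(ℓ)ℓ⁻¹)`) and the remark after **(12.8.1)** (p. 223; `E[3]` irreducible ⟹ every stable
`ℤ₃`-lattice of `V₃E` is `3^aT₃E`, with C. Wuthrich, Doc. Math. 19 (2014) Prop. 8); M. Kosters,
R. Pannekoek, arXiv:1703.07888, **Thm. 1 (ii)** ("`K/ℚ_p` unramified of degree `n` … `a_i ∈ pO_K` …
`E₀(K) ≅ ℤ_pⁿ` except … (ii) `p = 3` and `N_{k/𝔽_p}(\overline{8a₂/3}) = 1` … then `E₀(K) ≅ ℤ_pⁿ × ℤ/pℤ`"),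
**Cor. 2 (ii)** (`a₂ ≡ 6 mod 9` over `ℚ₃`), **Lemma 7**, **Prop. 10** and the **§3.3.1 table** (p. 7:
multiplication by `3` from `E₀/E₁ = k` to `E₁/E₂ = k` is `g = T − \overline{8a₂/3}·T³`; "if there is no
torsion in `E₀(K)`, then … one identifies `E₀(K)` with `O_K`"); and the local duality identity
`Tr_{K/ℚ_p}[exp*(x), W] = inv(x ∪ exp W)` (D. Delbourgo, J. Number Theory 95 (2002) p. 50; S. Bloch,
K. Kato 1990 §3; C.-H. Kim, K. Nakamura, J. Number Theory 210 (2020) p. 5 and Cor. 2.4: "The image of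
`H¹(K,T)/H¹_f(K,T)` under `exp*` is `O_K ω_E`" in the torsion-free case). DERIVATION = the sibling's items
1 (lattice), 3 (values, symmetric Euler factor) and 4 (unit choice: `c ≡ d ≡ 1 mod N`, `3 ∣ N` ⟹ `T ≡
(1 − χ̄(c))(1 − χ̄(d))`, a `3`-unit for `χ(c), χ(d)` generators of `μ_n`, `3 ∤ n`), with item 2
(receptacle) REPLACED by the following computation over `K_v = ℚ(ζ_m)_v ≅ ℚ_{3^f}` (unramified, `3 ∤ m`),
`ā := \overline{8a₂/3} ∈ 𝔽₃` for a model of `V` over `ℤ₃` with `a_i ∈ 3ℤ₃`: (P1) `M₀ := log_ω E₀(K_v) =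
{u ∈ O : ū ∈ im g} ⊇ 3O`, `g(x) = x − āx³` (`log E₁ = 3O`, `3E₁ = E₂`, `log T ≡ T mod 9`); (P2) the
trace-orthogonal of `im g` in `k` is `ℓ_ā = {y : y³ = āy}` (`Tr(y·āx³) = Tr((āy)^{1/3}x)`), of dimension
`≤ 1`, non-zero iff `N(ā) = 1` (= K–P (ii)); (P3) `R := M₀^∨ = O + 3⁻¹ℤ₃ỹ` with `σ(ỹ) ≡ āỹ (mod 3)`,
`ā ∈ {±1}` — the polar line is a Frobenius eigenline; (P4) `exp*_ω H¹(K_v, T₃E) ⊆ (log_ω E(K_v))^∨ ⊆ R`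
(integral cup product; stated with `E(K_v)`, so a component group of order `3` is harmless); (P5) for
`X ∈ ∏_{v∣3} R_v`, writing `X = X⁰ + 3⁻¹Y` with `σ₃Y ≡ āY (mod 3)`, the substitution `b ↦ 3b` gives
`(1 − χ(3)ā)·Σ_bχ(b)σ_b(Y) ≡ 0 (mod 3)`, and `1 − χ(3)ā` is a `3`-unit unless `χ(3)ā = 1` (orders prime
to `3`): `Σ_bχ(b)σ_b(X)` is `3`-integral whenever `χ(3)ā ≠ 1`, uniformly whenever `χ(3) ∉ {1, −1}`.
HENCE: for `V/ℚ` globally minimal with newform `f` at level `N`, additive at `3`, `E[3]` irreducible,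
`(m, 3N) = 1`, `χ` primitive mod `m`, `χ ≠ 1`, `3 ∤ ord χ`, `χ(3) ≠ 1`, `χ(3) ≠ −1`, `ϖ ∈ ℚ`, `r ∈ ℂ` with
(`χ` even) `ϖ·Ω(V) = Ω⁺_f`, `∏_{ℓ∥N}(ℓ − a_ℓχ(ℓ))(ℓ − a_ℓχ(ℓ)⁻¹)·Σ_aχ(a){∞,a/m}_f = r·Ω⁺_f`, resp. (`χ`
odd) `ϖ·|Ω⁻(V)| = Ω⁻_f`, same product `= r·Ω⁻_f·i`: `s·ϖ·r` is an algebraic integer for some `s ∈ ℕ`,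
`3 ∤ s`. Flag for the referee:
`Kato-(8.1.3)-9.7-6.6-KostersPannekoek-3.3.1-additive-three-twisted-Neron-reading-polar` (non-verbatim
steps: the sibling's three, and (P1)–(P5), which are written out in the module docstring, were checked by
two refuter seats of cell `pub/bsd-f2-manin` (REFUTER-ref1 §R34, REFUTER-ref2 §L⁷), and are not in print
as a statement — nearest printed phenomenon: Delbourgo 2002 §1, the correction `ℓ_p(E)` for the same
pole of `exp*`). No `_holds` (size XL).
[cite: Kato2004Asterisque, (8.1.3) (p. 180), Thm. 9.7 (p. 189), Thm. 6.6 (1) (p. 163), remark after (12.8.1) (p. 223)]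
[cite: KostersPannekoek2017, Thm. 1 (ii), Cor. 2 (ii), Lemma 7, Prop. 10, §3.3.1 (table p = 3)]
[cite: KimNakamura2020, §2.1 (perfect pairing) and Cor. 2.4] [cite: Delbourgo2002, p. 50 (duality identity), §1]
[cite: BlochKato1990, §3 (Prop. 3.8, Def. 3.10, (3.11))] [cite: Wuthrich2014, §3 Prop. 8]
[cite: MazurTateTeitelbaum1986, §I.8 (8.6)] -/
def kato_neron_isIntegral_twistedSymbolSum_of_additive_three_polar : Prop :=
  ∀ (V : WeierstrassCurve ℚ) [V.IsElliptic] [V.IsGloballyMinimal] {N : ℕ} [NeZero N]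
    (f : CuspForm (Gamma0 N) 2) (_ : IsNewformOf V f)
    (_ : ¬ V.HasGoodReductionAtPrime 3) (_ : ¬ V.HasMultiplicativeReductionAtPrime 3)
    (_ : V.HasIrreducibleModPGaloisRep 3) (m : ℕ) [NeZero m] (_ : m.Coprime (3 * N))
    (χ : DirichletCharacter ℂ m) (_ : χ.IsPrimitive) (_ : χ ≠ 1) (_ : ¬ 3 ∣ orderOf χ)
    (_ : χ (3 : ZMod m) ≠ 1) (_ : χ (3 : ZMod m) ≠ -1) (ϖ : ℚ) (r : ℂ),
    (χ.Even → (ϖ : ℝ) * V.realPeriodRat = plusPeriod f →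
      (∏ ℓ ∈ N.primeFactors with ¬ ℓ ^ 2 ∣ N,
          (((ℓ : ℂ) - (V.LFunction ℓ : ℂ) * χ (ℓ : ZMod m)) *
            ((ℓ : ℂ) - (V.LFunction ℓ : ℂ) * (χ (ℓ : ZMod m))⁻¹))) *
          twistedSymbolSum f χ = r * (plusPeriod f : ℂ) →
      ∃ s : ℕ, ¬ 3 ∣ s ∧ IsIntegral ℤ ((s : ℂ) * ϖ * r)) ∧
    (χ.Odd → (ϖ : ℝ) * V.imaginaryPeriodRat = minusPeriod f →
      (∏ ℓ ∈ N.primeFactors with ¬ ℓ ^ 2 ∣ N,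
          (((ℓ : ℂ) - (V.LFunction ℓ : ℂ) * χ (ℓ : ZMod m)) *
            ((ℓ : ℂ) - (V.LFunction ℓ : ℂ) * (χ (ℓ : ZMod m))⁻¹))) *
          twistedSymbolSum f χ = r * (minusPeriod f : ℂ) * Complex.I →
      ∃ s : ℕ, ¬ 3 ∣ s ∧ IsIntegral ℤ ((s : ℂ) * ϖ * r))

end Literature.NumberTheory.EllipticCurves

end
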